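import Summits.QuantumFields.YangMills.Theorems.BalabanUVNodesSpineCarriersOfRecord13Sep
import Summits.QuantumFields.YangMills.Theorems.BalabanUVNodesRateCarriersOfRecord13Sep
import Summits.QuantumFields.YangMills.Theorems.BalabanUVNodesN21ShellWeightKnit

/-!
⁗ (SEPARATION-GUARD) EDITION of this seat's module 21a (‴ edition p494514, g5) — dag-lead WORDS-140 (cell bus l.16872): the ‴ item (K3‴ `SpineGivenEndpointR13`, stmt-QuantumFields-19912) is an
ASIDE after route rev 18∕19; the lane of record is K3⁗ `SpineGivenEndpointR13Sep` (stmt-QuantumFields-20292; `--kind proof --supports stmt-QuantumFields-20292 --as helper`).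
STATEMENTS = the ‴ statements under node00-def-T's `Record13.lean` v1.2 token map (`Provisos₁₃ ↦ Provisos₁₃Sep`, `datumOfRecord₁₃ ↦ datumOfRecord₁₃Sep`,
`IsRecordOfRecord₁₃C ↦ IsRecordOfRecord₁₃CSep`), node00-def-RR-2's key names (`IsDatumOfRecord₁₃C(On) ↦ IsDatumOfRecord₁₃CSep(On)`, `Node00.Record13DatumKeySep`), dag-n22-e's (T-RATE) names
(`RateReading₁₃ ∕ rateCarriersOfRecord₁₃ ∕ RRec₁₃(On) ∕ readingOfRecord₁₃ ↦ …₁₃Sep…`) and the spine-home names of dag-n27-c's twins of dag-n20-d's modules (`SpineReading₁₃ ∕ SRec₁₃(On)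
∕ sRec₁₃ ∕ keyed₁₃ ∕ homes₁₃ ∕ rec13C ↦ …Sep…`); PROOFS VERBATIM under the map; θ-only declarations (`Stage13Params`, `Admissible`, `ZtUnity`, `SlotsNondegenerate₁₃`, `unityNondeg₁₃`,
RR-1's `ne3ConstLayerOfRecord₁₁`, THE END's letters) are NOT renamed.  Generated by this seat's `sep/gen.py` (suffix-parametric: the same pass serves a later `Sep ↦ …` re-key).

# YM-DAG node N21 (= NE7c) AT THE STAGE-13 SPINE-CARRIER HOME `YMDAG.UVSplit.SRec₁₃Sep cr`: THE WEIGHT LETTER `S.Wsh` IS N21's OWN OUTPUT — a Stage-13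
# spine reading can be RE-WEIGHTED by whatever summable weight NE7c produces, invisibly to N20, N27x and N19 (the ₁₃ twin of module 9
# `BalabanUVNodesN21AtSRec12Weight` §1–§3; director-ym LINE №125 «RECORD 13», dag-lead KEY TABLE WORDS-133: K3‴ `SpineGivenEndpointR13`)

Track A of `YM-PLAN.md` (cell `pub-ymgap`, HUMAN RULING D-0062), node **N21**; R134 fan-out seat `pub-ymgap-dag-n21-d` (s2 = BY-NAME KNIT at the record),
generation 5, module 21a.  THEOREMS ONLY: 0 `def`, 0 `sorry`, standard axioms; COUNT-NEUTRAL; `--supports` the K3⁗ item `SpineGivenEndpointR13Sep`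
(stmt-QuantumFields-20292) as a helper.  `N`-generic, NO Theses import (restate-immune), NO `Node00.Record13` import of its own (it comes with the ₁₃ home).
Imports dag-n20-d's ₁₃ (T-SPINE) home `BalabanUVNodesSpineCarriersOfRecord13Sep` (`SRec₁₃Sep`, `s_N21_sRec₁₃Sep_iff` — whose docstring says «dag-n21-d's ₁₃ closers plug in
at `SRec := SRec₁₃Sep cr`», `s_N20_sRec₁₃Sep_iff`, `s_N19_sRec₁₃Sep_iff`), dag-n22-e's (T-RATE) ₁₃ layer B `BalabanUVNodesRateCarriersOfRecord13Sep` (p493463: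
`RateReading₁₃Sep`, `rateCarriersOfRecord₁₃Sep` keyed by RR-2's `Node00.IsDatumOfRecord₁₃CSep`) and n21-a's file 1 `BalabanUVNodesN21ShellWeightKnit` (p408928:
`shellWeightBound_mono`, `shellWeightBound_of_le_geometric`).  Restates nothing; cites by name.  The ₁₂ module's §4 composite waits for dag-n27-c's ₁₃ home; it is NOT
re-typed here.

WHY (as at ₁₂).  Every N21 module of this lineage concludes NE7c at explicit carriers in the shape `∃ C ≥ 0, ShellWeightBound l₀ T A B shA shB (K ↦ C·ϑ^K)` — the
weight is PRODUCED inside the proof — while the K5 stub `S_N21 (SRec₁₃Sep cr)` (= plan g66's `K3Skeleton13.lean` `KeyedShellWeight cr` up to the keyed predicate) reads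
the weight slot `(cr F θ hP g₀ os).Wsh` OF THE READING.  §2 shows that re-weighting a reading (`cr ↦ fun F θ hP g₀ os ↦ { cr F θ hP g₀ os with Wsh := w F θ hP g₀ os }`)
leaves N20, N27x and N19 untouched, §3 chooses the weight from any ∃-weight N21 certificate (module 21b feeds it from the selection road at ₁₃).

WHAT IS PROVED ([folklore] ∕ [bookkeeping]; each step ONE application BY NAME or definitional).
* §1 `s_N21_sRec₁₃Sep_of_le_weight` · `s_N21_sRec₁₃Sep_of_le_geometric`.
* §2 `s_N21_sRec₁₃Sep_reweight_iff_forall` · `s_N20_sRec₁₃Sep_reweight_iff` · `s_N27x_sRec₁₃Sep_reweight_iff` · `s_N19_sRec₁₃Sep_reweight_iff` · `coreEdge₁₃Sep_reweight` (the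
  home-keyed N19′ edge shape of module 9's `coreEdge₁₂_reweight`, `12 ↦ 13`).
* §3 `exists_reweight_s_N21_sRec₁₃Sep`.

HONEST FRAMING (binding).  Bookkeeping by name: every K5 stub is a HYPOTHESIS with NO producer at any record today (0∕1); the reading `cr` is a PARAMETER (no reading
of Bałaban's dressed two-run expansion exists in the tree); no inhabitant of `Node00.IsRecordOfRecord₁₃CSep` claimed (K0‴ open); nothing of Bałaban's asserted;
NE7 ∕ NE7b ∕ NE7c NOT PRINTED for d = 4 and NOT PROVED; **N21 NOT discharged**, N27 NOT discharged, K3‴ NOT claimed; typed 28∕28, discharged count untouched; one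
finite four-torus programme at fixed `ε` — NOT ℝ⁴, NOT infinite volume, NOT OS, NOT a mass gap, NOT Clay.  No decl below carries a cite tag.
-/

set_option autoImplicit false

open Finset

namespace Summit.QuantumFields.YangMills.Theorems.N21AtSRec13SepWeight

open Literature.MathematicalPhysics.QuantumFieldTheory.Balaban1983to89
open Literature.MathematicalPhysics.QuantumFieldTheory.Balaban1983to89.T4Continuum (T4Family ULoop)
open T4WeightBudget (RelWeightBound)
open T4IndicatorShell (ShellWeightBound)
open Summit.QuantumFields.BalabanUV.T4Continuum.Spine
open YMDAG.UVSplit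
open Node00 (Stage13Params datumOfRecord₁₃Sep IsDatumOfRecord₁₃CSep)

variable {N : ℕ} [NeZero N] (cr : SpineReading₁₃Sep N)

/-! ## §1 A dominating summable weight slot carries the stub -/

/-- **A READING WHOSE WEIGHT SLOT DOMINATES A SHELL-WEIGHT BOUND CARRIES `S_N21 (SRec₁₃Sep cr)`.**  If at every admissible Stage-13 tuple with provisos and every
`(g₀, os)` SOME weight `Wsh` has `ShellWeightBound (cr …) … Wsh` with `Wsh ≤ (cr …).Wsh` pointwise and the slot `(cr …).Wsh` summable, then the K5 stub holds at the
reading (`shellWeightBound_mono`, `s_N21_sRec₁₃Sep_iff`).  HYPOTHESES only; NE7c NOT proved. [folklore] -/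
theorem s_N21_sRec₁₃Sep_of_le_weight
    (h : ∀ (F : T4Family) (θ : Stage13Params F N) (hP : θ.Provisos₁₃Sep F N), θ.Admissible F N → ∀ (g₀ : ℕ → ℝ) (os : List (ULoop F)),
      Summable (cr F θ hP g₀ os).Wsh ∧ ∃ Wsh : ℕ → ℝ,
        ShellWeightBound (cr F θ hP g₀ os).l₀ (cr F θ hP g₀ os).T (cr F θ hP g₀ os).A (cr F θ hP g₀ os).B (cr F θ hP g₀ os).shA
          (cr F θ hP g₀ os).shB Wsh ∧ ∀ K, Wsh K ≤ (cr F θ hP g₀ os).Wsh K) :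
    S_N21 (SRec₁₃Sep cr) := by
  refine (s_N21_sRec₁₃Sep_iff cr).2 fun F θ hP hθ g₀ os => ?_
  obtain ⟨hsum, Wsh, hSW, hle⟩ := h F θ hP hθ g₀ os
  exact shellWeightBound_mono hSW hle hsum

/-- **… IN PARTICULAR FOR A GEOMETRIC SLOT**: if the reading's weight slot IS `K ↦ c·ϑ^K` (`0 ≤ ϑ < 1`) at every admissible tuple and some shell-weight bound there has
weights `≤ c·ϑ^K`, the stub holds (`shellWeightBound_of_le_geometric`). [folklore] -/
theorem s_N21_sRec₁₃Sep_of_le_geometric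
    (h : ∀ (F : T4Family) (θ : Stage13Params F N) (hP : θ.Provisos₁₃Sep F N), θ.Admissible F N → ∀ (g₀ : ℕ → ℝ) (os : List (ULoop F)),
      ∃ c ϑ : ℝ, 0 ≤ ϑ ∧ ϑ < 1 ∧ (cr F θ hP g₀ os).Wsh = (fun K => c * ϑ ^ K) ∧ ∃ Wsh : ℕ → ℝ,
        ShellWeightBound (cr F θ hP g₀ os).l₀ (cr F θ hP g₀ os).T (cr F θ hP g₀ os).A (cr F θ hP g₀ os).B (cr F θ hP g₀ os).shA
          (cr F θ hP g₀ os).shB Wsh ∧ ∀ K, Wsh K ≤ c * ϑ ^ K) :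
    S_N21 (SRec₁₃Sep cr) := by
  refine (s_N21_sRec₁₃Sep_iff cr).2 fun F θ hP hθ g₀ os => ?_
  obtain ⟨c, ϑ, h0, h1, hslot, Wsh, hSW, hle⟩ := h F θ hP hθ g₀ os
  rw [hslot]
  exact shellWeightBound_of_le_geometric hSW h0 h1 hle

/-! ## §2 Re-weighting a reading is invisible to N20, N27x and N19 -/

section Reweight

variable (w : (F : T4Family) → (θ : Stage13Params F N) → θ.Provisos₁₃Sep F N → (ℕ → ℝ) → List (ULoop F) → ℕ → ℝ)

/-- **N21 AT THE RE-WEIGHTED READING** `fun F θ hP g₀ os ↦ { cr F θ hP g₀ os with Wsh := w F θ hP g₀ os }` IS «`ShellWeightBound (cr …) … (w …)` at every admissible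
Stage-13 tuple with provisos» (`s_N21_sRec₁₃Sep_iff`; the other fields are the reading's). [bookkeeping] -/
theorem s_N21_sRec₁₃Sep_reweight_iff_forall :
    S_N21 (SRec₁₃Sep fun F θ hP g₀ os => { cr F θ hP g₀ os with Wsh := w F θ hP g₀ os }) ↔
      ∀ (F : T4Family) (θ : Stage13Params F N) (hP : θ.Provisos₁₃Sep F N), θ.Admissible F N → ∀ (g₀ : ℕ → ℝ) (os : List (ULoop F)),
        ShellWeightBound (cr F θ hP g₀ os).l₀ (cr F θ hP g₀ os).T (cr F θ hP g₀ os).A (cr F θ hP g₀ os).B (cr F θ hP g₀ os).shA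
          (cr F θ hP g₀ os).shB (w F θ hP g₀ os) :=
  s_N21_sRec₁₃Sep_iff _

/-- **RE-WEIGHTING IS INVISIBLE TO N20** (`RelWeightBound` reads `l₀ T A B Bad W`). [bookkeeping] -/
theorem s_N20_sRec₁₃Sep_reweight_iff :
    S_N20 (SRec₁₃Sep fun F θ hP g₀ os => { cr F θ hP g₀ os with Wsh := w F θ hP g₀ os }) ↔ S_N20 (SRec₁₃Sep cr) := by
  rw [s_N20_sRec₁₃Sep_iff, s_N20_sRec₁₃Sep_iff]

/-- **RE-WEIGHTING IS INVISIBLE TO N27x** (positivity of `l₀`, `vol` and the E1∕E2 dictionary read `l₀ vol K₀ T A B`): at every record pair the re-weighted bundle is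
pinned exactly when the original is, with the same extraction data (`ForSmallCouplings.mono` per string). [bookkeeping] -/
theorem s_N27x_sRec₁₃Sep_reweight_iff (Rec : RecordPred N) :
    S_N27x Rec (SRec₁₃Sep fun F θ hP g₀ os => { cr F θ hP g₀ os with Wsh := w F θ hP g₀ os }) ↔ S_N27x Rec (SRec₁₃Sep cr) := by
  constructor
  · intro h F D w' hR hB hEnd
    refine (h F D w' hR hB hEnd).mono fun g₀ hg os => ?_
    obtain ⟨S, ⟨θ, hP, hθ, hD, rfl⟩, hl₀, hvol, hZA, hZB⟩ := hg os
    exact ⟨cr F θ hP g₀ os, ⟨θ, hP, hθ, hD, rfl⟩, hl₀, hvol, hZA, hZB⟩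
  · intro h F D w' hR hB hEnd
    refine (h F D w' hR hB hEnd).mono fun g₀ hg os => ?_
    obtain ⟨S, ⟨θ, hP, hθ, hD, rfl⟩, hl₀, hvol, hZA, hZB⟩ := hg os
    exact ⟨{ cr F θ hP g₀ os with Wsh := w F θ hP g₀ os }, ⟨θ, hP, hθ, hD, rfl⟩, hl₀, hvol, hZA, hZB⟩

/-- **RE-WEIGHTING IS INVISIBLE TO N19 AS THE EDGE** (`Spine.NE7.Core` on the shell-free cores reads `l₀ vol T Bad A shA B shB δ`), for every inputs predicate. [bookkeeping] -/
theorem s_N19_sRec₁₃Sep_reweight_iff (Inputs : InputsPred N) :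
    S_N19 (SRec₁₃Sep fun F θ hP g₀ os => { cr F θ hP g₀ os with Wsh := w F θ hP g₀ os }) Inputs ↔ S_N19 (SRec₁₃Sep cr) Inputs := by
  rw [s_N19_sRec₁₃Sep_iff, s_N19_sRec₁₃Sep_iff]

/-- **RE-WEIGHTING IS INVISIBLE TO THE HOME-KEYED N19′ EDGE** (module 9's `coreEdge₁₂_reweight` shape, `12 ↦ 13`: at every admissible Stage-13 tuple, every datum key of its
own datum and every run length, the six rates at the canonical rate bundle `rateCarriersOfRecord₁₃Sep 𝔯 F h.params h.provisos g₀ os k` (dag-n22-e p493463) give SOME summable `δ`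
carrying `Spine.NE7.Core` on the shell-free cores of the spine bundle). [bookkeeping] -/
theorem coreEdge₁₃Sep_reweight (𝔯 : RateReading₁₃Sep N)
    (h19 : ∀ (F : T4Family) (θ : Stage13Params F N) (hP : θ.Provisos₁₃Sep F N), θ.Admissible F N → ∀ (g₀ : ℕ → ℝ) (os : List (ULoop F))
      (h : IsDatumOfRecord₁₃CSep F N (datumOfRecord₁₃Sep F N θ hP)) (k : ℕ),
      RatesAt (datumOfRecord₁₃Sep F N θ hP) (rateCarriersOfRecord₁₃Sep 𝔯 F h.params h.provisos g₀ os k) → letI := (cr F θ hP g₀ os).dec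
        ∃ δ : ℕ → ℝ, NE7.Core (cr F θ hP g₀ os).l₀ (cr F θ hP g₀ os).vol (cr F θ hP g₀ os).T (cr F θ hP g₀ os).Bad
          (fun K t τ => (cr F θ hP g₀ os).A K t τ - (cr F θ hP g₀ os).shA K t τ) (fun K t τ => (cr F θ hP g₀ os).B K t τ - (cr F θ hP g₀ os).shB K t τ) δ ∧
          Summable δ)
    (F : T4Family) (θ : Stage13Params F N) (hP : θ.Provisos₁₃Sep F N) (hθ : θ.Admissible F N) (g₀ : ℕ → ℝ) (os : List (ULoop F))
    (h : IsDatumOfRecord₁₃CSep F N (datumOfRecord₁₃Sep F N θ hP)) (k : ℕ)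
    (hr : RatesAt (datumOfRecord₁₃Sep F N θ hP) (rateCarriersOfRecord₁₃Sep 𝔯 F h.params h.provisos g₀ os k)) :
    letI S : SpineCarriers := { cr F θ hP g₀ os with Wsh := w F θ hP g₀ os }
    letI := S.dec
    ∃ δ : ℕ → ℝ, NE7.Core S.l₀ S.vol S.T S.Bad (fun K t τ => S.A K t τ - S.shA K t τ) (fun K t τ => S.B K t τ - S.shB K t τ) δ ∧ Summable δ :=
  h19 F θ hP hθ g₀ os h k hr

end Reweight

/-! ## §3 Choosing the weight: from an ∃-weight certificate to the stub at a re-weighted reading -/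

/-- **THE WEIGHT CAN BE CHOSEN**: if at every admissible Stage-13 tuple with provisos and every `(g₀, os)` SOME weight `Wsh` has `ShellWeightBound (cr …) … Wsh` (the output
currency of every N21 module at explicit carriers — modules 5–8, 15, 18b ∕ 20 ∕ 20c — and of the NE7c swarm), then SOME re-weighting `w` of the reading carries the K5 stub
`S_N21 (SRec₁₃Sep (re-weighted cr))` (classical choice per tuple; `s_N21_sRec₁₃Sep_iff`).  HYPOTHESIS only; NE7c NOT proved. [folklore] -/
theorem exists_reweight_s_N21_sRec₁₃Sep
    (hW : ∀ (F : T4Family) (θ : Stage13Params F N) (hP : θ.Provisos₁₃Sep F N), θ.Admissible F N → ∀ (g₀ : ℕ → ℝ) (os : List (ULoop F)),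
      ∃ Wsh : ℕ → ℝ, ShellWeightBound (cr F θ hP g₀ os).l₀ (cr F θ hP g₀ os).T (cr F θ hP g₀ os).A (cr F θ hP g₀ os).B (cr F θ hP g₀ os).shA
        (cr F θ hP g₀ os).shB Wsh) :
    ∃ w : (F : T4Family) → (θ : Stage13Params F N) → θ.Provisos₁₃Sep F N → (ℕ → ℝ) → List (ULoop F) → ℕ → ℝ,
      S_N21 (SRec₁₃Sep fun F θ hP g₀ os => { cr F θ hP g₀ os with Wsh := w F θ hP g₀ os }) := by
  classical
  refine ⟨fun F θ hP g₀ os => if hθ : θ.Admissible F N then (hW F θ hP hθ g₀ os).choose else (cr F θ hP g₀ os).Wsh, ?_⟩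
  refine (s_N21_sRec₁₃Sep_reweight_iff_forall cr _).2 fun F θ hP hθ g₀ os => ?_
  rw [dif_pos hθ]
  exact (hW F θ hP hθ g₀ os).choose_spec

end Summit.QuantumFields.YangMills.Theorems.N21AtSRec13SepWeight
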